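import Mathlib
import Literature.Combinatorics.Enumerative.InvolutionsAvoiding3412And123
import HarnessLib

/-!
# Fixed-point-free involutions avoiding `3412` and `123`: `|DI_{2h}(3412, 123)| = 1 + binom(h, 2)` (Barnabei–Bonetti–Silimbani 2011, Theorem 12 (a))

Layer `Literature/Combinatorics/Enumerative`, namespace `Literature.Combinatorics.Enumerative.PermContainsPattern`; lane
`lit-hodgefound` (prover seat p13, generation 39, theme «nonnesting / noncrossing matchings and restricted
involutions»).  Sequel of `InvolutionsAvoiding3412And123.lean` (THEOREM 8 (iv): a `3412`- and `123`-avoiding involution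
is either connected — `β_ρ`, the outer arc around `ρ ∈ I_{n−2}(3412,123)` — or the two reversal blocks
`k ⋯ 1 n ⋯ k+1` = `twoRev n (k−1)`).

## Source

M. Barnabei, F. Bonetti, M. Silimbani, *Restricted involutions and Motzkin paths*, Adv. Appl. Math. **47** (2011)
102–115 = arXiv:0812.0463 [BarnabeiBonettiSilimbani2011] (held text `paper-arxiv-0812.0463`, arXiv numbering, §6):

> **Theorem 12.** For every integer `n`, we have: a. `|DI_{2h}(3412,123)| = 1 + binom(h, 2)`; b. …
> Proof. a. Non-connected involutions in `DI_{2h}(3412,123)` correspond bijectively to Dyck paths of type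
> `D = U^a D^a U^{h−a} D^{h−a}`, where `0 < a < h`. There are `h − 1` involutions of this type. As seen in the proof of
> Theorem 8.iv, connected involutions in `DI_{2h}(3412,123)` are in bijection with involutions in `DI_{2h−2}(3412,123)`.
> Hence, if we set `d_{2h} = |DI_{2h}(3412,123)|`, we have: `d_{2h} = d_{2h−2} + h − 1`. Since `d_2 = 1`, we get the
> assertion.

## Formalisation (arc language)

* §1 `twoRev_fixedPointFree_iff`: the two reversal blocks `twoRev n j` (sizes `j+1`, `n−j−1`) have no fixed point iff
  both sizes are even; `arcBlock_fixedPointFree_iff`: `β_ρ` has no fixed point iff `ρ` has none.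
* §2 Sorting `DI_{b+2}(3412, 123)` by the first letter: connected ones ↔ `DI_b(3412, 123)`
  (`card_fpf_av3412_av123_connected`), one involution for each odd first letter `j` when `b` is even and none otherwise
  (`card_fpf_av3412_av123_first`); ★★ `card_fpf_av3412_av123_add_two`: `d_{b+2} = d_b + [b even] · b/2`.
* §3 ★★★ THEOREM 12 (a): `card_fpf_av3412_av123_two_mul : |DI_{2h}(3412, 123)| = 1 + binom(h, 2)`, and
  `card_fpf_av3412_av123_odd : |DI_{2h+1}(3412, 123)| = 0`.
-/

namespace Literature.Combinatorics.Enumerative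

namespace PermContainsPattern

open Finset Equiv
open Literature.Computability.AlgebraicComplexity

variable {n b : ℕ}

/-! ### §1 Fixed points of the two blocks -/

/-- `twoRev n j` (the reversal of `[0, j]` next to the reversal of `(j, n)`) has no fixed point iff both blocks have
even size, i.e. `j` is odd and `n + j` is odd. [cite: BarnabeiBonettiSilimbani2011, Theorem 12 (a) (proof:
«`D = U^a D^a U^{h−a} D^{h−a}`»; arXiv 0812.0463)] -/
theorem twoRev_fixedPointFree_iff (n j : ℕ) (hj : j < n) :
    (∀ y : Fin n, twoRev n j hj y ≠ y) ↔ j % 2 = 1 ∧ (n + j) % 2 = 1 := by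
  constructor
  · intro h
    by_contra hc
    rcases Nat.even_or_odd j with ⟨a, ha⟩ | hodd
    · refine h ⟨a, by omega⟩ (Fin.ext ?_)
      rw [twoRev_val, if_pos (show ((⟨a, by omega⟩ : Fin n) : ℕ) ≤ j by simp; omega)]
      change j - a = a
      omega
    · obtain ⟨a, ha⟩ := hodd
      have hnj : (n + j) % 2 = 0 := by omega
      refine h ⟨(n + j) / 2, by omega⟩ (Fin.ext ?_)
      rw [twoRev_val, if_neg (show ¬ ((⟨(n + j) / 2, by omega⟩ : Fin n) : ℕ) ≤ j by simp; omega)]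
      change n + j - (n + j) / 2 = (n + j) / 2
      omega
  · rintro ⟨h1, h2⟩ y e
    have := congrArg Fin.val e
    rw [twoRev_val] at this
    split_ifs at this <;> omega

/-- `β_ρ` has no fixed point iff `ρ` has none (`0 ↔ last` are exchanged). [cite: BarnabeiBonettiSilimbani2011, Theorem 12 (a) (proof; arXiv 0812.0463)] -/
theorem arcBlock_fixedPointFree_iff (ρ : Perm (Fin b)) :
    (∀ y : Fin (b + 1 + 1), (swap (0 : Fin (b + 1 + 1)) (Fin.last (b + 1)) * finSumFinEquiv.symm.trans
      (((Perm.decomposeFin.symm (0, ρ) : Perm (Fin (b + 1))).sumCongr (1 : Perm (Fin 1))).trans finSumFinEquiv)) y ≠ y) ↔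
      ∀ x : Fin b, ρ x ≠ x := by
  constructor
  · intro h x hx
    refine h (Fin.castAdd 1 x.succ) ?_
    rw [arcBlock_apply_mid, hx]
  · intro h y hy
    have hval := congrArg Fin.val hy
    by_cases h0 : y = 0
    · subst h0
      rw [arcBlock_apply_zero, Fin.val_last, Fin.val_zero] at hval
      omega
    by_cases hl : y = Fin.last (b + 1)
    · subst hl
      rw [arcBlock_apply_last, Fin.val_last, Fin.val_zero] at hval
      omega
    · obtain ⟨x, rfl⟩ : ∃ x : Fin b, y = Fin.castAdd 1 x.succ := by
        refine ⟨⟨(y : ℕ) - 1, ?_⟩, Fin.ext ?_⟩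
        · have h1 : (y : ℕ) ≠ 0 := fun e => h0 (Fin.ext (by rw [e]; simp))
          have h2 : (y : ℕ) ≠ b + 1 := fun e => hl (Fin.ext (by rw [e, Fin.val_last]))
          have := y.2; omega
        · have h1 : (y : ℕ) ≠ 0 := fun e => h0 (Fin.ext (by rw [e]; simp))
          simp; omega
      rw [arcBlock_apply_mid] at hy
      exact h x (Fin.succ_injective _ (Fin.castAdd_injective _ _ hy))

/-! ### §2 Sorting `DI_{b+2}(3412, 123)` by the first letter -/

/-- ★ The connected fixed-point-free involutions of `DI_{b+2}(3412, 123)` (first letter `last`) are the `β_ρ`,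
`ρ ∈ DI_b(3412, 123)`. [cite: BarnabeiBonettiSilimbani2011, Theorem 12 (a) (proof; arXiv 0812.0463)] -/
theorem card_fpf_av3412_av123_connected (b : ℕ) :
    Nat.card {u : Perm (Fin (b + 1 + 1)) // ((u * u = 1 ∧ ¬ PermContainsPattern u ![3, 4, 1, 2] ∧
        ¬ PermContainsPattern u ![1, 2, 3]) ∧ ∀ i, u i ≠ i) ∧ u 0 = Fin.last (b + 1)} =
      Nat.card {ρ : Perm (Fin b) // (ρ * ρ = 1 ∧ ¬ PermContainsPattern ρ ![3, 4, 1, 2] ∧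
        ¬ PermContainsPattern ρ ![1, 2, 3]) ∧ ∀ i, ρ i ≠ i} := by
  refine (Nat.card_congr (Equiv.ofBijective (fun ρ : {ρ : Perm (Fin b) // (ρ * ρ = 1 ∧
      ¬ PermContainsPattern ρ ![3, 4, 1, 2] ∧ ¬ PermContainsPattern ρ ![1, 2, 3]) ∧ ∀ i, ρ i ≠ i} =>
    (⟨swap (0 : Fin (b + 1 + 1)) (Fin.last (b + 1)) * finSumFinEquiv.symm.trans
        (((Perm.decomposeFin.symm (0, ρ.1) : Perm (Fin (b + 1))).sumCongr (1 : Perm (Fin 1))).trans finSumFinEquiv),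
      ⟨⟨(arcBlock_mul_self_eq_one_iff ρ.1).2 ρ.2.1.1,
        (arcBlock_not_contains_3412_iff ((mul_self_eq_one_iff_apply_apply _).1 ρ.2.1.1)).2 ρ.2.1.2.1,
        (arcBlock_not_contains_123_iff ρ.1).2 ρ.2.1.2.2⟩, (arcBlock_fixedPointFree_iff ρ.1).2 ρ.2.2⟩,
      arcBlock_apply_zero ρ.1⟩ :
    {u : Perm (Fin (b + 1 + 1)) // ((u * u = 1 ∧ ¬ PermContainsPattern u ![3, 4, 1, 2] ∧
      ¬ PermContainsPattern u ![1, 2, 3]) ∧ ∀ i, u i ≠ i) ∧ u 0 = Fin.last (b + 1)})) ⟨?_, ?_⟩)).symm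
  · rintro ⟨ρ, hρ⟩ ⟨ρ', hρ'⟩ h
    exact Subtype.ext (arcBlock_injective b (congrArg Subtype.val h))
  · rintro ⟨u, ⟨⟨hinv, h3412, h123⟩, hfp⟩, h0⟩
    have hu : ∀ x, u (u x) = x := (mul_self_eq_one_iff_apply_apply u).1 hinv
    obtain ⟨ρ, rfl⟩ := exists_eq_arcBlock u hu h0
    have hρinv : ρ * ρ = 1 := (arcBlock_mul_self_eq_one_iff ρ).1 hinv
    have hρu : ∀ x, ρ (ρ x) = x := (mul_self_eq_one_iff_apply_apply ρ).1 hρinv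
    exact ⟨⟨ρ, ⟨hρinv, (arcBlock_not_contains_3412_iff hρu).1 h3412, (arcBlock_not_contains_123_iff ρ).1 h123⟩,
      (arcBlock_fixedPointFree_iff ρ).1 hfp⟩, rfl⟩

/-- ★ The fibre over a first letter `j < last`: the single candidate `twoRev (b+2) j` is fixed-point-free iff `j` is odd
and `b` is even («Dyck paths of type `U^a D^a U^{h−a} D^{h−a}`, `0 < a < h`»).
[cite: BarnabeiBonettiSilimbani2011, Theorem 12 (a) (proof; arXiv 0812.0463)] -/
theorem card_fpf_av3412_av123_first (b : ℕ) (j : Fin (b + 1 + 1)) (hj : j ≠ Fin.last (b + 1)) :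
    Nat.card {u : Perm (Fin (b + 1 + 1)) // ((u * u = 1 ∧ ¬ PermContainsPattern u ![3, 4, 1, 2] ∧
        ¬ PermContainsPattern u ![1, 2, 3]) ∧ ∀ i, u i ≠ i) ∧ u 0 = j} =
      if (j : ℕ) % 2 = 1 ∧ b % 2 = 0 then 1 else 0 := by
  have hjl : (j : ℕ) < b + 1 := lt_of_le_of_ne (Nat.lt_succ_iff.1 j.2) fun e => hj (Fin.ext (by rw [e, Fin.val_last]))
  have huniq : ∀ u : Perm (Fin (b + 1 + 1)), ((u * u = 1 ∧ ¬ PermContainsPattern u ![3, 4, 1, 2] ∧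
      ¬ PermContainsPattern u ![1, 2, 3]) ∧ ∀ i, u i ≠ i) ∧ u 0 = j → u = twoRev (b + 1 + 1) j j.2 :=
    fun u ⟨⟨⟨hinv, h3412, h123⟩, _⟩, h0⟩ =>
      eq_twoRev ((mul_self_eq_one_iff_apply_apply u).1 hinv) h3412 h123 (congrArg Fin.val h0) hjl
  split_ifs with hc
  · have : Unique {u : Perm (Fin (b + 1 + 1)) // ((u * u = 1 ∧ ¬ PermContainsPattern u ![3, 4, 1, 2] ∧
        ¬ PermContainsPattern u ![1, 2, 3]) ∧ ∀ i, u i ≠ i) ∧ u 0 = j} :=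
      { default := ⟨twoRev (b + 1 + 1) j j.2, ⟨twoRev_mem _ _ _,
          (twoRev_fixedPointFree_iff _ _ j.2).2 ⟨hc.1, by omega⟩⟩, Fin.ext (by rw [twoRev_val]; simp)⟩
        uniq := fun u => Subtype.ext (huniq u.1 u.2) }
    exact Nat.card_unique
  · rw [Nat.card_eq_zero]
    left
    refine ⟨fun u => ?_⟩
    have e := huniq u.1 u.2
    have hfp := u.2.1.2
    rw [e] at hfp
    have := (twoRev_fixedPointFree_iff _ _ j.2).1 hfp
    exact hc ⟨this.1, by omega⟩

/-- Splitting a finite subtype along a statistic with values in a `Fintype`. [folklore] -/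
private theorem card_subtype_eq_sum_fiber₆ {α β : Type*} [Finite α] [Fintype β] (P : α → Prop) (f : α → β) :
    Nat.card {x // P x} = ∑ t : β, Nat.card {x // P x ∧ f x = t} := by
  rw [← Nat.card_sigma]
  exact Nat.card_congr ((Equiv.sigmaFiberEquiv fun x : {x // P x} => f x.1).symm.trans
    (Equiv.sigmaCongrRight fun t => Equiv.subtypeSubtypeEquivSubtypeInter P fun x => f x = t))

/-- The number of odd numbers below `m`: `m / 2`. [folklore] -/
private theorem card_filter_range_odd (m : ℕ) : ((range m).filter fun j => j % 2 = 1).card = m / 2 := by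
  induction m with
  | zero => simp
  | succ m ih =>
    rw [Finset.range_add_one, filter_insert]
    split_ifs with h
    · rw [card_insert_of_notMem (by simp), ih]; omega
    · rw [ih]; omega

/-- The number of odd letters among the first `m`: `m / 2`. [folklore] -/
private theorem sum_fin_ite_odd (m : ℕ) : ∑ j : Fin m, (if (j : ℕ) % 2 = 1 then 1 else 0) = m / 2 := by
  rw [Fin.sum_univ_eq_sum_range (fun j => if j % 2 = 1 then 1 else 0) m, sum_boole, ← card_filter_range_odd m]
  simp

/-- ★★ **The recurrence** `d_{b+2} = d_b + [b even] · b/2`: a connected involution (`β_ρ`), or the two even reversal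
blocks `k ⋯ 1 n ⋯ k+1` with `k = j + 1` even. [cite: BarnabeiBonettiSilimbani2011, Theorem 12 (a) («`d_{2h} = d_{2h−2} + h − 1`»; arXiv 0812.0463)] -/
theorem card_fpf_av3412_av123_add_two (b : ℕ) :
    Nat.card {u : Perm (Fin (b + 2)) // (u * u = 1 ∧ ¬ PermContainsPattern u ![3, 4, 1, 2] ∧
        ¬ PermContainsPattern u ![1, 2, 3]) ∧ ∀ i, u i ≠ i} =
      Nat.card {u : Perm (Fin b) // (u * u = 1 ∧ ¬ PermContainsPattern u ![3, 4, 1, 2] ∧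
          ¬ PermContainsPattern u ![1, 2, 3]) ∧ ∀ i, u i ≠ i} + if b % 2 = 0 then b / 2 else 0 := by
  rw [card_subtype_eq_sum_fiber₆ (fun u : Perm (Fin (b + 2)) => (u * u = 1 ∧ ¬ PermContainsPattern u ![3, 4, 1, 2] ∧
      ¬ PermContainsPattern u ![1, 2, 3]) ∧ ∀ i, u i ≠ i) (fun u => u 0), Fin.sum_univ_castSucc,
    Finset.sum_congr rfl fun j _ => card_fpf_av3412_av123_first b _ (ne_of_lt (Fin.castSucc_lt_last j)),
    card_fpf_av3412_av123_connected, add_comm]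
  congr 1
  simp only [Fin.val_castSucc]
  by_cases hb : b % 2 = 0
  · rw [if_pos hb]
    simp only [hb, and_true]
    rw [sum_fin_ite_odd]
    omega
  · rw [if_neg hb]
    simp [hb]

/-! ### §3 THEOREM 12 (a) -/

/-- `d_0 = 1`. [cite: BarnabeiBonettiSilimbani2011, Theorem 12 (a) (arXiv 0812.0463)] -/
theorem card_fpf_av3412_av123_zero :
    Nat.card {u : Perm (Fin 0) // (u * u = 1 ∧ ¬ PermContainsPattern u ![3, 4, 1, 2] ∧
      ¬ PermContainsPattern u ![1, 2, 3]) ∧ ∀ i, u i ≠ i} = 1 := by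
  have : Unique {u : Perm (Fin 0) // (u * u = 1 ∧ ¬ PermContainsPattern u ![3, 4, 1, 2] ∧
      ¬ PermContainsPattern u ![1, 2, 3]) ∧ ∀ i, u i ≠ i} :=
    { default := ⟨1, ⟨by simp, not_contains_of_lt _ _ (by norm_num), not_contains_of_lt _ _ (by norm_num)⟩,
        fun i => Fin.elim0 i⟩
      uniq := fun u => Subtype.ext (Equiv.ext fun x => Fin.elim0 x) }
  exact Nat.card_unique

/-- ★★★ **THEOREM 12 (a) (Barnabei–Bonetti–Silimbani): `|DI_{2h}(3412, 123)| = 1 + binom(h, 2)`.**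
[cite: BarnabeiBonettiSilimbani2011, Theorem 12 (a) (arXiv 0812.0463)] -/
theorem card_fpf_av3412_av123_two_mul (h : ℕ) :
    Nat.card {u : Perm (Fin (2 * h)) // (u * u = 1 ∧ ¬ PermContainsPattern u ![3, 4, 1, 2] ∧
      ¬ PermContainsPattern u ![1, 2, 3]) ∧ ∀ i, u i ≠ i} = 1 + h.choose 2 := by
  induction h with
  | zero => rw [Nat.mul_zero, card_fpf_av3412_av123_zero]; rfl
  | succ h ih =>
    rw [show 2 * (h + 1) = 2 * h + 2 by ring, card_fpf_av3412_av123_add_two, ih, if_pos (by omega),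
      Nat.mul_div_cancel_left _ Nat.two_pos, Nat.choose_succ_succ', Nat.choose_one_right]
    ring

/-- There is no fixed-point-free involution of an odd number of letters: `|DI_{2h+1}(3412, 123)| = 0`.
[cite: BarnabeiBonettiSilimbani2011, §6 («this set is nonempty if and only if `n = 2h` is even»; arXiv 0812.0463)] -/
theorem card_fpf_av3412_av123_odd (h : ℕ) :
    Nat.card {u : Perm (Fin (2 * h + 1)) // (u * u = 1 ∧ ¬ PermContainsPattern u ![3, 4, 1, 2] ∧
      ¬ PermContainsPattern u ![1, 2, 3]) ∧ ∀ i, u i ≠ i} = 0 := by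
  rw [Nat.card_eq_zero]
  left
  refine ⟨fun ⟨u, ⟨hinv, _, _⟩, hfp⟩ => ?_⟩
  have hmem : (⇑u) ∈ perfectMatchings (2 * h + 1) :=
    mem_perfectMatchings.2 ⟨(mul_self_eq_one_iff_apply_apply u).1 hinv, hfp⟩
  rw [perfectMatchings_odd] at hmem
  exact absurd hmem (Finset.notMem_empty _)

/-- Values: `|DI_{2h}(3412, 123)| = 1, 1, 2, 4, 7, 11` for `h = 0, …, 5`. [cite: BarnabeiBonettiSilimbani2011, Theorem 12 (a) (arXiv 0812.0463)] -/
theorem card_fpf_av3412_av123_values :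
    (List.range 6).map (fun h => Nat.card {u : Perm (Fin (2 * h)) // (u * u = 1 ∧ ¬ PermContainsPattern u ![3, 4, 1, 2] ∧
      ¬ PermContainsPattern u ![1, 2, 3]) ∧ ∀ i, u i ≠ i}) = [1, 1, 2, 4, 7, 11] := by
  simp only [card_fpf_av3412_av123_two_mul]
  decide

end PermContainsPattern

end Literature.Combinatorics.Enumerative
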